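import Literature.NumberTheory.LFunctions.CertifiedDirichletLTuringLowerBound
import Literature.NumberTheory.LFunctions.DirichletXiPairMultiplicity
import Literature.Analysis.Complex.DeBruijnUniversalFactorsThm6Proofs
import HarnessLib

/-!
# Turing's method for Dirichlet `L`-functions: the zeros' part of the lower bound (Trudgian 2011,
# proof of Lemma 3.7, `I₂ ≥ −d²(log 4) Σ_ρ Re 1/(s_d − ρ)`), for the PAIR `Ξ_χ = ξ(·,χ)ξ(·,χ̄)` — proved

T. S. Trudgian, *Improvements to Turing's method*, Math. Comp. **80** (2011), §3.4, proof of Lemma 3.7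
(arXiv:0903.1885 pp. 9–10): "The application of Lemma 2.7 to `I₂`, with zeroes `ρ` paired with
`1 − ρ̄`, gives `I₂ ≥ −d²(log 4) Σ_ρ Re(1/(d + ½ + it − ρ))`."  Second layer of the Dirichlet-`L` twin of
`TuringLowerBound.lean` (after `CertifiedDirichletLTuringLowerBound.lean`).  Everything here is a
theorem (conditional, like the `ζ` file, on exactly one named fact already in the tree: Booker's
integral inequality `Trudgian2011_lemma_2_10`, Trudgian's Lemma 2.7/2.10); no new named fact.

The tree's Hadamard product for Dirichlet characters is that of the symmetric pair
`Ξ_χ(s) = ξ(s, χ) ξ(s, χ̄)` (`DirichletTheta.exists_xiPair_hadamardSeq`, genus zero in `(s−½)²`: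
`Ξ_χ(½ + z)/Ξ_χ(2) = ∏ₙ (1 − bₙ(z² − 9/4))`, each non-zero `bₙ` carrying the pair of zeros
`{ρₙ, 1 − ρₙ}` of `Ξ_χ`).  Accordingly the zeros' part is proved here for the pair — which is the form
Turing's method for `χ` actually consumes (`TuringDirichlet.turing_lehman_lower_bound` bounds
`∫S_χ + ∫S_χ̄`):

* `TuringDirichlet.xiPairLift_conj` — the even lift `G_χ(w) = Ξ_χ(½ + w^{1/2})` is real:
  `G_χ(w̄) = conj G_χ(w)`; hence (`exists_perm_eq_conj_pair`) the Hadamard multiset `{bₙ}` is closed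
  under conjugation with multiplicities (a permutation `π` of `ℕ` with `b ∘ π = conj ∘ b`), the device
  that pairs `ρ` with `1 − ρ̄` (the tree's `IsHadamardSeq.exists_perm_eq_conj` for `ξ`).
* `TuringDirichlet.hasSum_log_norm_pairFactors_sub` —
  `log|Ξ_χ(s)| − log|Ξ_χ(s')| = Σₙ (log|fₙ(s)| − log|fₙ(s')|)`, `fₙ(s) = 1 − bₙ((s−½)² − 9/4)`.
* `TuringDirichlet.neg_pairPhi_add_conj_le` — Booker's inequality for one factor and its conjugate:
  the zeros `ρₙ, 1−ρₙ, ρ̄ₙ, 1−ρ̄ₙ` regroup into the Booker pairs `{ρₙ, 1−ρ̄ₙ}`, `{1−ρₙ, ρ̄ₙ}`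
  (the tree's `booker_pair_le`).
* `TuringDirichlet.integral_log_norm_xiPair_sub_shift_ge` — **the zeros' part for the pair**: for
  `½ < d ≤ 1` and `t` the ordinate of no zero of `L(s, χ)L(s, χ̄)` in the critical strip,
  `∫_{1/2}^{1/2+d} (log|Ξ_χ(σ+it)| − log|Ξ_χ(σ+d+it)|) dσ ≥ −d² log 4 · Re Ξ_χ'/Ξ_χ(½ + d + it)`,
  conditionally on `Trudgian2011_lemma_2_10`.

Conventions: `Ξ_χ = DirichletTheta.xiPair χ`, `ξ(s,χ) = DirichletTheta.dirichletXi χ s`, `g_ρ`, `h_ρ` the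
one-zero integrand / real part of the `ζ` file (`gZero`, `hZero`).

## References
* T. S. Trudgian, Improvements to Turing's method, Math. Comp. 80 (2011) 2259–2279, §3.4 proof of
  Lemma 3.7, §2.2 Lemmas 2.7, 2.10 (arXiv:0903.1885 pp. 5–6, 9–10). [Trudgian2011]
* A. R. Booker, Artin's conjecture, Turing's method, and the Riemann hypothesis, Experiment. Math.
  15 (2006), Lemma 4.4. [Booker2006]
* J. B. Conway, Functions of One Complex Variable I, Ch. XI Thm. 3.4 (Hadamard). [Conway1978]
-/

noncomputable section

open Complex Set MeasureTheory intervalIntegral Filter Topology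
open scoped Real ComplexConjugate

namespace Literature.NumberTheory.LFunctions

open DirichletTheta DirichletCharacter ExplicitPsiChar

namespace TuringDirichlet

variable {q : ℕ} [NeZero q] {χ : DirichletCharacter ℂ q}

/-! ### The even lift is real; conjugation symmetry of the Hadamard multiset -/

/-- **`G_χ(w̄) = conj G_χ(w)`** for the even lift `G_χ(w) = Ξ_χ(½ + w^{1/2})` of a primitive `χ ≠ 1`
(`conj Ξ_χ(s) = Ξ_χ(s̄)` and `Ξ_χ(½ + z) = Ξ_χ(½ − z)`; off the negative axis `(w̄)^{1/2} = conj(w^{1/2})`,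
on it `w^{1/2}` is purely imaginary). [cite: Conway1978, Ch. XI Thm. 3.4] -/
theorem xiPairLift_conj (hχ : χ.IsPrimitive) (h1 : χ ≠ 1) (w : ℂ) :
    xiPairLift χ (conj w) = conj (xiPairLift χ w) := by
  unfold xiPairLift
  rw [conj_xiPair h1, map_add]
  have h12 : conj ((1 : ℂ) / 2) = 1 / 2 := by
    rw [map_div₀, map_one, map_ofNat]
  rw [h12]
  by_cases harg : w.arg = π
  · obtain ⟨hre, him⟩ := Complex.arg_eq_pi_iff.mp harg
    have hw : conj w = w := Complex.conj_eq_iff_im.mpr him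
    rw [hw]
    set u : ℂ := w ^ ((2 : ℂ)⁻¹) with hu
    have hu2 : u ^ 2 = w := Literature.Analysis.Complex.KiKim.cpow_half_sq w
    have hre' : u.re * u.re - u.im * u.im < 0 := by
      have := congrArg Complex.re hu2
      rw [sq, Complex.mul_re] at this
      linarith
    have him' : u.re * u.im = 0 := by
      have := congrArg Complex.im hu2
      rw [sq, Complex.mul_im, him] at this
      linarith
    have hure : u.re = 0 := by
      rcases mul_eq_zero.mp him' with h | h
      · exact h
      · exfalso; rw [h, mul_zero, sub_zero] at hre'; nlinarith [mul_self_nonneg u.re]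
    have hconj : conj u = -u := Complex.ext (by simp [hure]) (by simp)
    rw [hconj, ← xiPair_half_add_neg hχ u]
  · rw [Complex.conj_cpow w _ harg, map_inv₀, map_ofNat]

/-- Fibres of a summable sequence over a non-zero value are finite. [folklore] -/
private theorem finite_fibre {b : ℕ → ℂ} (hbs : Summable fun n ↦ ‖b n‖) {c : ℂ} (hc : c ≠ 0) :
    {n : ℕ | b n = c}.Finite := by
  have h0 := hbs.tendsto_cofinite_zero
  have hev : ∀ᶠ n in cofinite, ‖b n‖ < ‖c‖ := h0.eventually (gt_mem_nhds (norm_pos_iff.mpr hc))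
  refine (Filter.eventually_cofinite.mp hev).subset fun n hn ↦ ?_
  simp only [mem_setOf_eq] at hn ⊢
  rw [hn]
  exact lt_irrefl _

/-- **Conjugation symmetry of the Hadamard multiset of `Ξ_χ`**: for a Hadamard sequence `b` of
`Ξ_χ` at the base point `9/4` (non-zero values `bₙ = 1/a` indexing the zeros `a` of
`w ↦ G_χ(w + 9/4)` with multiplicity) there is a permutation `e` of the indices with
`b (e n) = conj (b n)` (`G_χ` is real, so `ord_{ā} = ord_a`). The `Ξ_χ`-twin of the tree's
`IsHadamardSeq.exists_perm_eq_conj`. [cite: Conway1978, Ch. XI Thm. 3.4] -/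
theorem exists_perm_eq_conj_pair (hχ : χ.IsPrimitive) (h1 : χ ≠ 1) {b : ℕ → ℂ}
    (hbs : Summable fun n ↦ ‖b n‖)
    (hmult : ∀ a : ℂ, a ≠ 0 →
      {n : ℕ | b n = a⁻¹}.ncard = analyticOrderNatAt (fun w ↦ xiPairLift χ (w + 9 / 4)) a) :
    ∃ e : ℕ ≃ ℕ, ∀ n, b (e n) = conj (b n) := by
  set G : ℂ → ℂ := fun w ↦ xiPairLift χ (w + 9 / 4) with hG
  have hGd : Differentiable ℂ G :=
    (differentiable_xiPairLift hχ h1).comp (differentiable_id.add_const _)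
  have hGs : ∀ z, G (conj z) = conj (G z) := by
    intro z
    simp only [hG]
    rw [← xiPairLift_conj hχ h1]
    congr 1
    rw [map_add, map_div₀, map_ofNat, map_ofNat]
  -- multiplicity of a value `c ≠ 0`
  have hcard : ∀ c : ℂ, c ≠ 0 → {n : ℕ | b n = c}.ncard = analyticOrderNatAt G c⁻¹ := by
    intro c hc
    have := hmult c⁻¹ (inv_ne_zero hc)
    rwa [inv_inv] at this
  set b' : ℕ → ℂ := fun n ↦ conj (b n) with hb'
  have e : ∀ a : ℂ, {n : ℕ // b' n = a} ≃ {n : ℕ // b n = a} := by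
    intro a
    by_cases ha : a = 0
    · refine Equiv.subtypeEquivRight fun n ↦ ?_
      simp [hb', ha]
    · have hca : conj a ≠ 0 := (map_ne_zero _).mpr ha
      have s2 : {n : ℕ | b' n = a} = {n : ℕ | b n = conj a} := by
        ext n
        simp only [mem_setOf_eq, hb']
        constructor
        · intro hn; rw [← hn, Complex.conj_conj]
        · intro hn; rw [hn, Complex.conj_conj]
      haveI : Finite {n : ℕ | b n = a} := finite_fibre hbs ha
      haveI : Finite {n : ℕ | b' n = a} := by rw [s2]; exact finite_fibre hbs hca
      have hc : Nat.card {n : ℕ | b' n = a} = Nat.card {n : ℕ | b n = a} := by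
        rw [Nat.card_congr (Equiv.setCongr s2), Nat.card_coe_set_eq, Nat.card_coe_set_eq,
          hcard _ hca, hcard _ ha, ← map_inv₀,
          Literature.Analysis.Complex.DeBruijn1950.analyticOrderNatAt_conj hGd hGs]
      exact (Finite.card_eq.1 hc).some
  refine ⟨Equiv.ofFiberEquiv e, fun n ↦ ?_⟩
  have := Equiv.ofFiberEquiv_map e n
  simpa [hb'] using this

/-! ### The Hadamard factors of the pair: `fₙ(s) = 1 − bₙ((s−½)² − 9/4)` -/

/-- **Termwise logarithm of the Hadamard product of `Ξ_χ`**: where `Ξ_χ(s), Ξ_χ(s') ≠ 0`,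
`log|Ξ_χ(s)| − log|Ξ_χ(s')| = Σₙ (log|fₙ(s)| − log|fₙ(s')|)`. [cite: Conway1978, Ch. XI Thm. 3.4] -/
theorem hasSum_log_norm_pairFactors_sub {b : ℕ → ℂ} (h2 : xiPair χ 2 ≠ 0)
    (hprod : ∀ z : ℂ, HasProd (fun n ↦ 1 - b n * (z ^ 2 - 9 / 4)) (xiPair χ (1 / 2 + z) / xiPair χ 2))
    {s s' : ℂ} (hs : xiPair χ s ≠ 0) (hs' : xiPair χ s' ≠ 0) :
    HasSum (fun n ↦ Real.log ‖1 - b n * ((s - 1 / 2) ^ 2 - 9 / 4)‖ -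
        Real.log ‖1 - b n * ((s' - 1 / 2) ^ 2 - 9 / 4)‖)
      (Real.log ‖xiPair χ s‖ - Real.log ‖xiPair χ s'‖) := by
  have key : ∀ {s : ℂ}, xiPair χ s ≠ 0 →
      HasSum (fun n ↦ Real.log ‖1 - b n * ((s - 1 / 2) ^ 2 - 9 / 4)‖)
        (Real.log ‖xiPair χ s / xiPair χ 2‖) := by
    intro s hs
    have hp := hprod (s - 1 / 2)
    rw [add_sub_cancel] at hp
    have hL : xiPair χ s / xiPair χ 2 ≠ 0 := div_ne_zero hs h2
    have hcont : ContinuousAt (fun w : ℂ ↦ Real.log ‖w‖) (xiPair χ s / xiPair χ 2) :=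
      (continuous_norm.continuousAt).log (norm_ne_zero_iff.2 hL)
    have ht := hcont.tendsto.comp hp
    refine ht.congr fun S ↦ ?_
    simp only [Function.comp_apply]
    rw [norm_prod, Real.log_prod]
    intro n _
    exact norm_ne_zero_iff.2 (factor_ne_zero_of_xiPair_ne_zero h2 hprod hs n)
  have h := (key hs).sub (key hs')
  have e : Real.log ‖xiPair χ s / xiPair χ 2‖ - Real.log ‖xiPair χ s' / xiPair χ 2‖ =
      Real.log ‖xiPair χ s‖ - Real.log ‖xiPair χ s'‖ := by
    rw [norm_div, norm_div, Real.log_div (norm_ne_zero_iff.2 hs) (norm_ne_zero_iff.2 h2),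
      Real.log_div (norm_ne_zero_iff.2 hs') (norm_ne_zero_iff.2 h2)]
    ring
  rwa [e] at h

/-- Factorisation of a pair factor at any of its roots: if `β ≠ 0` and `(ρ − ½)² = 9/4 + 1/β` then
`1 − β((s−½)² − 9/4) = −β (s−ρ)(s−(1−ρ))`. [folklore] -/
private theorem pairFactor_eq_of_root {β ρ : ℂ} (hβ : β ≠ 0) (hρ : (ρ - 1 / 2) ^ 2 = 9 / 4 + β⁻¹)
    (s : ℂ) : 1 - β * ((s - 1 / 2) ^ 2 - 9 / 4) = -β * ((s - ρ) * (s - (1 - ρ))) := by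
  have e : (s - ρ) * (s - (1 - ρ)) = (s - 1 / 2) ^ 2 - (ρ - 1 / 2) ^ 2 := by ring
  rw [e, hρ]
  field_simp
  ring

/-- The conjugate root belongs to the conjugate parameter. [folklore] -/
private theorem conj_root' {β ρ : ℂ} (hρ : (ρ - 1 / 2) ^ 2 = 9 / 4 + β⁻¹) :
    (conj ρ - 1 / 2) ^ 2 = 9 / 4 + (conj β)⁻¹ := by
  have h := congrArg conj hρ
  simp only [map_pow, map_sub, map_div₀, map_one, map_add, map_inv₀, map_ofNat] at h
  exact h

/-- The Hadamard root `ρₙ` satisfies `(ρₙ − ½)² = 9/4 + 1/bₙ`. [folklore] -/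
private theorem xiPairZero_root (b : ℕ → ℂ) (n : ℕ) :
    (xiPairZero b n - 1 / 2) ^ 2 = 9 / 4 + (b n)⁻¹ := by
  rw [xiPairZero, add_sub_cancel_left, Literature.Analysis.Complex.KiKim.cpow_half_sq]

/-- Logarithm of a pair factor off its zeros:
`log|1 − β((s−½)² − 9/4)| = log|β| + log|s−ρ| + log|s−(1−ρ)|`. [folklore] -/
private theorem log_norm_pairFactor_eq_of_root {β ρ s : ℂ} (hβ : β ≠ 0)
    (hρ : (ρ - 1 / 2) ^ 2 = 9 / 4 + β⁻¹) (h1 : s ≠ ρ) (h2 : s ≠ 1 - ρ) :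
    Real.log ‖1 - β * ((s - 1 / 2) ^ 2 - 9 / 4)‖ =
      Real.log ‖β‖ + Real.log ‖s - ρ‖ + Real.log ‖s - (1 - ρ)‖ := by
  have h1' : ‖s - ρ‖ ≠ 0 := norm_ne_zero_iff.2 (sub_ne_zero.2 h1)
  have h2' : ‖s - (1 - ρ)‖ ≠ 0 := norm_ne_zero_iff.2 (sub_ne_zero.2 h2)
  have hβ' : ‖β‖ ≠ 0 := norm_ne_zero_iff.2 hβ
  rw [pairFactor_eq_of_root hβ hρ]
  have e : ‖-β * ((s - ρ) * (s - (1 - ρ)))‖ = ‖β‖ * (‖s - ρ‖ * ‖s - (1 - ρ)‖) := by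
    simp only [norm_mul, norm_neg]
  rw [e, Real.log_mul hβ' (mul_ne_zero h1' h2'), Real.log_mul h1' h2']
  ring

/-- One pair factor splits into its two zeros along `Im s = t`: for `β ≠ 0`, `(ρ−½)² = 9/4 + 1/β`
and `t` not the ordinate of `ρ` or `1 − ρ`,
`log|f(σ+it)| − log|f(σ+d+it)| = g_ρ(σ) + g_{1−ρ}(σ)`. [folklore] -/
private theorem pairPhi_eq_of_root {d t : ℝ} {β ρ : ℂ} (hβ : β ≠ 0)
    (hρ : (ρ - 1 / 2) ^ 2 = 9 / 4 + β⁻¹) (him : ρ.im ≠ t) (him' : (1 - ρ).im ≠ t) (σ : ℝ) :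
    Real.log ‖1 - β * ((((σ : ℂ) + t * I) - 1 / 2) ^ 2 - 9 / 4)‖ -
        Real.log ‖1 - β * (((((σ + d : ℝ) : ℂ) + t * I) - 1 / 2) ^ 2 - 9 / 4)‖ =
      gZero d t ρ σ + gZero d t (1 - ρ) σ := by
  have ne_of_im_ne : ∀ {s ρ : ℂ}, s.im ≠ ρ.im → s ≠ ρ := fun h e ↦ h (by rw [e])
  have hs : ∀ x : ℝ, ((x : ℂ) + t * I) ≠ ρ ∧ ((x : ℂ) + t * I) ≠ 1 - ρ := fun x ↦
    ⟨ne_of_im_ne (by simpa using Ne.symm him), ne_of_im_ne (by simpa using Ne.symm him')⟩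
  simp only [gZero]
  rw [log_norm_pairFactor_eq_of_root hβ hρ (hs σ).1 (hs σ).2,
    log_norm_pairFactor_eq_of_root hβ hρ (hs (σ + d)).1 (hs (σ + d)).2]
  ring

/-- The log-derivative term of one pair factor at `s_d = ½ + d + it` splits into its two zeros:
`Re (−2β(s_d−½)/(1 − β((s_d−½)² − 9/4))) = h_ρ + h_{1−ρ}` (`β ≠ 0`, `0 ≤ Re ρ ≤ 1`, `d > ½`).
[folklore] -/
private theorem pairH_eq_of_root {d t : ℝ} {β ρ : ℂ} (hβ : β ≠ 0)
    (hρ : (ρ - 1 / 2) ^ 2 = 9 / 4 + β⁻¹) (h0 : 0 ≤ ρ.re) (h1 : ρ.re ≤ 1) (hd : 1 / 2 < d) :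
    (-(2 * β * ((((1 / 2 + d : ℝ) : ℂ) + t * I) - 1 / 2)) /
        (1 - β * (((((1 / 2 + d : ℝ) : ℂ) + t * I) - 1 / 2) ^ 2 - 9 / 4))).re =
      hZero d t ρ + hZero d t (1 - ρ) := by
  set s : ℂ := ((1 / 2 + d : ℝ) : ℂ) + t * I with hs
  have ne_of_re_ne : ∀ {s ρ : ℂ}, s.re ≠ ρ.re → s ≠ ρ := fun h e ↦ h (by rw [e])
  have hne1 : s ≠ ρ := ne_of_re_ne (by simp [hs]; linarith)
  have hne2 : s ≠ 1 - ρ := ne_of_re_ne (by simp [hs]; linarith)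
  have h1' : s - ρ ≠ 0 := sub_ne_zero.2 hne1
  have h2' : s - (1 - ρ) ≠ 0 := sub_ne_zero.2 hne2
  have e : -(2 * β * (s - 1 / 2)) / (1 - β * ((s - 1 / 2) ^ 2 - 9 / 4)) =
      1 / (s - ρ) + 1 / (s - (1 - ρ)) := by
    rw [pairFactor_eq_of_root hβ hρ]
    field_simp
    ring
  simp only [hZero]
  rw [e, Complex.add_re]

/-! ### Booker's inequality for one factor and its conjugate -/

/-- **Booker's inequality for one Hadamard factor of `Ξ_χ` and its conjugate** (`½ < d ≤ 1`, `t` not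
an ordinate of a zero of `Ξ_χ`): with `Φ(β) = ∫_{1/2}^{1/2+d} (log|f_β(σ+it)| − log|f_β(σ+d+it)|) dσ`
and `H(β) = Re(−2β(s_d−½)/f_β(s_d))`, `−(Φ(bₙ) + Φ(b̄ₙ)) ≤ d² log 4 · (H(bₙ) + H(b̄ₙ))`: the zeros
`ρₙ, 1−ρₙ` of the factor and `ρ̄ₙ, 1−ρ̄ₙ` of its conjugate regroup into the Booker pairs
`{ρₙ, 1−ρ̄ₙ}`, `{1−ρₙ, ρ̄ₙ}` (Trudgian: "zeroes `ρ` paired with `1 − ρ̄`").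
[cite: Trudgian2011, §3.4 proof of Lemma 3.7 (application of Lemma 2.7)] -/
theorem neg_pairPhi_add_conj_le (hB : Trudgian2011_lemma_2_10) (hχ : χ.IsPrimitive) (h1 : χ ≠ 1)
    {b : ℕ → ℂ}
    (hprod : ∀ z : ℂ, HasProd (fun n ↦ 1 - b n * (z ^ 2 - 9 / 4)) (xiPair χ (1 / 2 + z) / xiPair χ 2))
    {d t : ℝ} (hd : 1 / 2 < d) (hd1 : d ≤ 1) (hord : ∀ ρ : ℂ, xiPair χ ρ = 0 → ρ.im ≠ t) (n : ℕ) :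
    -((∫ σ in (1 / 2 : ℝ)..(1 / 2 + d),
          (Real.log ‖1 - b n * ((((σ : ℂ) + t * I) - 1 / 2) ^ 2 - 9 / 4)‖ -
            Real.log ‖1 - b n * (((((σ + d : ℝ) : ℂ) + t * I) - 1 / 2) ^ 2 - 9 / 4)‖)) +
        ∫ σ in (1 / 2 : ℝ)..(1 / 2 + d),
          (Real.log ‖1 - conj (b n) * ((((σ : ℂ) + t * I) - 1 / 2) ^ 2 - 9 / 4)‖ -
            Real.log ‖1 - conj (b n) * (((((σ + d : ℝ) : ℂ) + t * I) - 1 / 2) ^ 2 - 9 / 4)‖)) ≤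
      d ^ 2 * Real.log 4 *
        ((-(2 * b n * ((((1 / 2 + d : ℝ) : ℂ) + t * I) - 1 / 2)) /
            (1 - b n * (((((1 / 2 + d : ℝ) : ℂ) + t * I) - 1 / 2) ^ 2 - 9 / 4))).re +
          (-(2 * conj (b n) * ((((1 / 2 + d : ℝ) : ℂ) + t * I) - 1 / 2)) /
            (1 - conj (b n) * (((((1 / 2 + d : ℝ) : ℂ) + t * I) - 1 / 2) ^ 2 - 9 / 4))).re) := by
  by_cases hn : b n = 0
  · simp [hn]
  have h2 := xiPair_two_ne_zero hχ h1
  set β := b n with hβ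
  set ρ := xiPairZero b n with hρdef
  have hρ : (ρ - 1 / 2) ^ 2 = 9 / 4 + β⁻¹ := xiPairZero_root b n
  have hΞρ : xiPair χ ρ = 0 := xiPair_xiPairZero h2 hprod hn
  have hΞ1 : xiPair χ (1 - ρ) = 0 := xiPair_one_sub_xiPairZero h2 hprod hn
  have hΞc : xiPair χ (conj ρ) = 0 := by rw [← conj_xiPair h1, hΞρ, map_zero]
  have hΞc1 : xiPair χ (1 - conj ρ) = 0 := by
    rw [show (1 : ℂ) - conj ρ = conj (1 - ρ) by simp, ← conj_xiPair h1, hΞ1, map_zero]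
  obtain ⟨hre0, hre1⟩ := re_mem_Ioo_of_xiPair_eq_zero hχ h1 hΞρ
  have himρ : ρ.im ≠ t := hord ρ hΞρ
  have him1 : (1 - ρ).im ≠ t := hord _ hΞ1
  have himc : (conj ρ).im ≠ t := hord _ hΞc
  have himc1 : (1 - conj ρ).im ≠ t := hord _ hΞc1
  have hρc := conj_root' hρ
  have hβc : conj β ≠ 0 := (map_ne_zero _).2 hn
  have e1 := intervalIntegral.integral_congr (μ := volume) (a := (1 / 2 : ℝ)) (b := 1 / 2 + d)
    fun σ _ ↦ pairPhi_eq_of_root (d := d) hn hρ himρ him1 σ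
  have e2 := intervalIntegral.integral_congr (μ := volume) (a := (1 / 2 : ℝ)) (b := 1 / 2 + d)
    fun σ _ ↦ pairPhi_eq_of_root (d := d) hβc hρc himc himc1 σ
  have e3 := pairH_eq_of_root (t := t) hn hρ hre0.le hre1.le hd
  have e4 := pairH_eq_of_root (t := t) hβc hρc (by simp; exact hre0.le) (by simp; exact hre1.le) hd
  have B1 := booker_pair_le hB hd hd1 hre0.le hre1.le himρ
  have B2 := booker_pair_le hB hd hd1 (ρ₀ := 1 - ρ) (by simp; linarith) (by simp; linarith) him1
  have ec : (1 : ℂ) - conj (1 - ρ) = conj ρ := by simp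
  rw [ec] at B2
  have hgi : ∀ ρ₀ : ℂ, ρ₀.im ≠ t → IntervalIntegrable (gZero d t ρ₀) volume (1 / 2) (1 / 2 + d) :=
    fun ρ₀ h ↦ (continuous_gZero h).intervalIntegrable _ _
  rw [intervalIntegral.integral_add (hgi ρ himρ) (hgi _ himc1)] at B1
  rw [intervalIntegral.integral_add (hgi _ him1) (hgi _ himc)] at B2
  rw [e1, e2, e3, e4, intervalIntegral.integral_add (hgi ρ himρ) (hgi _ him1),
    intervalIntegral.integral_add (hgi _ himc) (hgi _ himc1)]
  linarith

/-! ### Termwise integration of the Hadamard series along `[½, ½ + d]` -/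

/-- No zero of `Ξ_χ` on the line `Im s = t` when `t` is not an ordinate. [folklore] -/
private theorem xiPair_ne_zero_of_im {t : ℝ} (hord : ∀ ρ : ℂ, xiPair χ ρ = 0 → ρ.im ≠ t) (x : ℝ) :
    xiPair χ (x + t * I) ≠ 0 := fun h ↦ hord _ h (by simp)

/-- `σ ↦ log|fₙ(σ+it)| − log|fₙ(σ+d+it)|` is continuous when `t` is not an ordinate of a zero of `Ξ_χ`
(no factor vanishes on the line). [folklore] -/
private theorem continuous_pairPhi {b : ℕ → ℂ} (h2 : xiPair χ 2 ≠ 0)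
    (hprod : ∀ z : ℂ, HasProd (fun n ↦ 1 - b n * (z ^ 2 - 9 / 4)) (xiPair χ (1 / 2 + z) / xiPair χ 2))
    {d t : ℝ} (hord : ∀ ρ : ℂ, xiPair χ ρ = 0 → ρ.im ≠ t) (n : ℕ) :
    Continuous fun σ : ℝ ↦
      Real.log ‖1 - b n * ((((σ : ℂ) + t * I) - 1 / 2) ^ 2 - 9 / 4)‖ -
        Real.log ‖1 - b n * (((((σ + d : ℝ) : ℂ) + t * I) - 1 / 2) ^ 2 - 9 / 4)‖ := by
  have hf : ∀ x : ℝ, 1 - b n * ((((x : ℂ) + t * I) - 1 / 2) ^ 2 - 9 / 4) ≠ 0 := fun x ↦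
    factor_ne_zero_of_xiPair_ne_zero h2 hprod (xiPair_ne_zero_of_im hord x) n
  have h1 : Continuous fun σ : ℝ ↦
      Real.log ‖1 - b n * ((((σ : ℂ) + t * I) - 1 / 2) ^ 2 - 9 / 4)‖ :=
    continuous_iff_continuousAt.2 fun σ ↦
      ((by fun_prop : Continuous fun σ : ℝ ↦
        1 - b n * ((((σ : ℂ) + t * I) - 1 / 2) ^ 2 - 9 / 4)).continuousAt.norm).log
        (norm_ne_zero_iff.2 (hf σ))
  have h2' : Continuous fun σ : ℝ ↦
      Real.log ‖1 - b n * (((((σ + d : ℝ) : ℂ) + t * I) - 1 / 2) ^ 2 - 9 / 4)‖ :=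
    h1.comp (continuous_id.add continuous_const : Continuous fun σ : ℝ ↦ σ + d)
  exact h1.sub h2'

/-- Uniform smallness of the far factors on the segment: if `‖β‖ (7 + t²) ≤ ½` then
`|log|f_β(σ+it)| − log|f_β(σ+d+it)|| ≤ 3 (7 + t²) ‖β‖` for `σ ∈ [½, 3/2]`, `0 ≤ d ≤ 1`
(`|log|1−z|| ≤ (3/2)|z|` for `|z| ≤ ½`, and `|(s−½)² − 9/4| ≤ 7 + t²` for `½ ≤ Re s ≤ 5/2`, `Im s = t`).
[folklore] -/
private theorem abs_pairPhi_le {β : ℂ} {d t σ : ℝ} (hd : 0 ≤ d) (hd1 : d ≤ 1)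
    (hσ : σ ∈ Icc (1 / 2 : ℝ) (3 / 2)) (hβ : ‖β‖ * (7 + t ^ 2) ≤ 1 / 2) :
    |Real.log ‖1 - β * ((((σ : ℂ) + t * I) - 1 / 2) ^ 2 - 9 / 4)‖ -
        Real.log ‖1 - β * (((((σ + d : ℝ) : ℂ) + t * I) - 1 / 2) ^ 2 - 9 / 4)‖| ≤
      3 * (7 + t ^ 2) * ‖β‖ := by
  set R : ℝ := 7 + t ^ 2 with hR
  have hsq : ∀ x : ℝ, 1 / 2 ≤ x → x ≤ 5 / 2 → ‖(((x : ℂ) + t * I) - 1 / 2) ^ 2 - 9 / 4‖ ≤ R := by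
    intro x hx1 hx2
    have e : ((x : ℂ) + t * I) - 1 / 2 = ((x - 1 / 2 : ℝ) : ℂ) + (t : ℝ) * I := by
      push_cast; ring
    calc ‖(((x : ℂ) + t * I) - 1 / 2) ^ 2 - 9 / 4‖
        ≤ ‖(((x : ℂ) + t * I) - 1 / 2) ^ 2‖ + ‖(9 / 4 : ℂ)‖ := norm_sub_le _ _
      _ = ‖((x : ℂ) + t * I) - 1 / 2‖ ^ 2 + 9 / 4 := by
          rw [norm_pow]; norm_num
      _ = (x - 1 / 2) ^ 2 + t ^ 2 + 9 / 4 := by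
          rw [e, Complex.norm_add_mul_I, Real.sq_sqrt (by positivity)]
      _ ≤ R := by rw [hR]; nlinarith
  have hz : ∀ x : ℝ, 1 / 2 ≤ x → x ≤ 5 / 2 →
      |Real.log ‖1 - β * ((((x : ℂ) + t * I) - 1 / 2) ^ 2 - 9 / 4)‖| ≤ 3 / 2 * (‖β‖ * R) := by
    intro x hx1 hx2
    set z : ℂ := β * ((((x : ℂ) + t * I) - 1 / 2) ^ 2 - 9 / 4) with hzdef
    have hz1 : ‖z‖ ≤ ‖β‖ * R := by
      rw [hzdef, norm_mul]; exact mul_le_mul_of_nonneg_left (hsq x hx1 hx2) (norm_nonneg _)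
    have hw : ‖(1 - z) - 1‖ ≤ 1 / 2 := by
      rw [sub_sub_cancel_left, norm_neg]; linarith
    have := abs_log_norm_le_of_norm_sub_one_le hw
    rw [sub_sub_cancel_left, norm_neg] at this
    linarith
  have hA := hz σ hσ.1 (by linarith [hσ.2])
  have hB := hz (σ + d) (by linarith [hσ.1]) (by linarith [hσ.2])
  have := abs_sub (Real.log ‖1 - β * ((((σ : ℂ) + t * I) - 1 / 2) ^ 2 - 9 / 4)‖)
    (Real.log ‖1 - β * (((((σ + d : ℝ) : ℂ) + t * I) - 1 / 2) ^ 2 - 9 / 4)‖)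
  linarith

/-- **Termwise integration of the Hadamard series for `log|Ξ_χ(s)| − log|Ξ_χ(s+d)|`**: for a Hadamard
sequence `b` of `Ξ_χ`, `0 ≤ d ≤ 1` and `t` not an ordinate of a zero of `Ξ_χ`,
`Σₙ ∫_{1/2}^{1/2+d} (log|fₙ(σ+it)| − log|fₙ(σ+d+it)|) dσ = ∫_{1/2}^{1/2+d} (log|Ξ_χ(σ+it)| − log|Ξ_χ(σ+d+it)|) dσ`
(dominated convergence: all but finitely many terms are `≤ 3(7+t²)‖bₙ‖` uniformly, the others are
continuous). [cite: Conway1978, Ch. XI Thm. 3.4] -/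
theorem hasSum_integral_pairPhi {b : ℕ → ℂ} (hbs : Summable fun n ↦ ‖b n‖) (h2 : xiPair χ 2 ≠ 0)
    (hprod : ∀ z : ℂ, HasProd (fun n ↦ 1 - b n * (z ^ 2 - 9 / 4)) (xiPair χ (1 / 2 + z) / xiPair χ 2))
    {d t : ℝ} (hd : 0 ≤ d) (hd1 : d ≤ 1) (hord : ∀ ρ : ℂ, xiPair χ ρ = 0 → ρ.im ≠ t) :
    HasSum (fun n ↦ ∫ σ in (1 / 2 : ℝ)..(1 / 2 + d),
        (Real.log ‖1 - b n * ((((σ : ℂ) + t * I) - 1 / 2) ^ 2 - 9 / 4)‖ -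
          Real.log ‖1 - b n * (((((σ + d : ℝ) : ℂ) + t * I) - 1 / 2) ^ 2 - 9 / 4)‖))
      (∫ σ in (1 / 2 : ℝ)..(1 / 2 + d),
        (Real.log ‖xiPair χ (σ + t * I)‖ - Real.log ‖xiPair χ ((σ + d : ℝ) + t * I)‖)) := by
  have hΞ : ∀ x : ℝ, xiPair χ (x + t * I) ≠ 0 := xiPair_ne_zero_of_im hord
  have hcont := continuous_pairPhi h2 hprod hord (d := d) (t := t) (b := b)
  set R : ℝ := 7 + t ^ 2 with hR
  have hR0 : 0 < R := by positivity
  obtain ⟨N, hN⟩ : ∃ N : ℕ, ∀ n, N ≤ n → ‖b n‖ * R ≤ 1 / 2 := by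
    have h0 := hbs.tendsto_atTop_zero
    have hev := (h0.eventually (gt_mem_nhds (show (0:ℝ) < 1 / (2 * R) by positivity)))
    obtain ⟨N, hN⟩ := eventually_atTop.1 hev
    refine ⟨N, fun n hn ↦ ?_⟩
    have := hN n hn
    rw [lt_div_iff₀ (by positivity)] at this
    linarith
  set φ : ℕ → ℝ → ℝ := fun n σ ↦
    Real.log ‖1 - b n * ((((σ : ℂ) + t * I) - 1 / 2) ^ 2 - 9 / 4)‖ -
      Real.log ‖1 - b n * (((((σ + d : ℝ) : ℂ) + t * I) - 1 / 2) ^ 2 - 9 / 4)‖ with hφ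
  choose Cf hCf using fun n ↦
    (isCompact_Icc : IsCompact (Icc (1 / 2 : ℝ) (1 / 2 + d))).exists_bound_of_continuousOn
      (f := φ n) (hcont n).continuousOn
  set M : ℝ := ∑ k ∈ Finset.range N, |Cf k| with hM
  set C : ℕ → ℝ := fun n ↦ 3 * R * ‖b n‖ + if n < N then M else 0 with hC
  have hCsum : Summable C := by
    refine (hbs.mul_left (3 * R)).add (summable_of_ne_finset_zero (s := Finset.range N) ?_)
    intro n hn
    rw [Finset.mem_range] at hn
    simp [hn]
  have hbound : ∀ n, ∀ σ ∈ Icc (1 / 2 : ℝ) (1 / 2 + d), ‖φ n σ‖ ≤ C n := by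
    intro n σ hσ
    by_cases hn : n < N
    · have h1 : ‖φ n σ‖ ≤ |Cf n| := (hCf n σ hσ).trans (le_abs_self _)
      have h2' : |Cf n| ≤ M :=
        Finset.single_le_sum (f := fun k ↦ |Cf k|) (fun k _ ↦ abs_nonneg _) (Finset.mem_range.2 hn)
      have h3 : 0 ≤ 3 * R * ‖b n‖ := by positivity
      simp only [hC, if_pos hn]
      linarith
    · have hle := abs_pairPhi_le (β := b n) (t := t) hd hd1 ⟨hσ.1, by linarith [hσ.2]⟩
        (hN n (not_lt.1 hn))
      simp only [hC, if_neg hn, add_zero, Real.norm_eq_abs, hφ]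
      linarith
  refine intervalIntegral.hasSum_integral_of_dominated_convergence (fun n _ ↦ C n)
    (fun n ↦ (hcont n).aestronglyMeasurable) ?_ ?_ ?_ ?_
  · intro n
    refine Filter.Eventually.of_forall fun σ hσ ↦ hbound n σ ?_
    rw [uIoc_of_le (by linarith)] at hσ
    exact ⟨hσ.1.le, hσ.2⟩
  · exact Filter.Eventually.of_forall fun σ _ ↦ hCsum
  · exact intervalIntegrable_const
  · refine Filter.Eventually.of_forall fun σ _ ↦ ?_
    have h := hasSum_log_norm_pairFactors_sub h2 hprod (hΞ σ) (hΞ (σ + d))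
    exact h

/-! ### The zeros' part for the pair -/

/-- The ordinate condition for `Ξ_χ` from those for `L(s, χ)` and `L(s, χ̄)`: a zero of `Ξ_χ` is a
zero of `ξ(·, χ)` or of `ξ(·, χ̄)`, i.e. a non-trivial zero of `L(s, χ)` or of `L(s, χ̄)`. [folklore] -/
private theorem xiPair_ordinate_ne (hχ : χ.IsPrimitive) (h1 : χ ≠ 1) {t : ℝ}
    (hz : ∀ ρ ∈ charNontrivialZeros χ, ρ.im ≠ t) (hz' : ∀ ρ ∈ charNontrivialZeros χ⁻¹, ρ.im ≠ t) :
    ∀ ρ : ℂ, xiPair χ ρ = 0 → ρ.im ≠ t := by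
  intro ρ hρ
  have hinv : χ⁻¹.IsPrimitive := by
    rw [DirichletCharacter.isPrimitive_def, DirichletCharacter.conductor_inv]; exact hχ
  rcases mul_eq_zero.mp hρ with h | h
  · exact hz ρ ((dirichletXi_eq_zero_iff_mem_charNontrivialZeros hχ h1 ρ).1 h)
  · exact hz' ρ ((dirichletXi_eq_zero_iff_mem_charNontrivialZeros hinv (inv_ne_one.mpr h1) ρ).1 h)

/-- **The zeros' part of Trudgian's lower bound, for the pair `Ξ_χ = ξ(·,χ)ξ(·,χ̄)`** (§3.4, proof of
Lemma 3.7: "`I₂ ≥ −d²(log 4) Σ_ρ Re(1/(d + ½ + it − ρ))`", summed here over the zeros of `L(s,χ)` AND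
`L(s,χ̄)`, and with `Σ_ρ Re 1/(s_d − ρ) = Re Ξ_χ'/Ξ_χ(s_d)` by the Hadamard product): for a primitive
`χ ≠ 1`, `½ < d ≤ 1`, `t` the ordinate of no zero of `Ξ_χ`,
`∫_{1/2}^{1/2+d} (log|Ξ_χ(σ+it)| − log|Ξ_χ(σ+d+it)|) dσ ≥ −d² log 4 · Re Ξ_χ'/Ξ_χ(½ + d + it)`,
conditionally on Booker's inequality `Trudgian2011_lemma_2_10` (Trudgian's Lemma 2.7).
[cite: Trudgian2011, §3.4 proof of Lemma 3.7 (application of Lemma 2.7)] -/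
theorem integral_log_norm_xiPair_sub_shift_ge (hB : Trudgian2011_lemma_2_10) (hχ : χ.IsPrimitive)
    (h1 : χ ≠ 1) {d t : ℝ} (hd : 1 / 2 < d) (hd1 : d ≤ 1)
    (hord : ∀ ρ : ℂ, xiPair χ ρ = 0 → ρ.im ≠ t) :
    -(d ^ 2 * Real.log 4 * (logDeriv (xiPair χ) (((1 / 2 + d : ℝ) : ℂ) + t * I)).re) ≤
      ∫ σ in (1 / 2 : ℝ)..(1 / 2 + d),
        (Real.log ‖xiPair χ (σ + t * I)‖ - Real.log ‖xiPair χ ((σ + d : ℝ) + t * I)‖) := by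
  obtain ⟨b, hbs, -, hmult, hprod⟩ := exists_xiPair_hadamardSeq hχ h1
  have h2 := xiPair_two_ne_zero hχ h1
  set sd : ℂ := ((1 / 2 + d : ℝ) : ℂ) + t * I with hsd
  have hsd0 : xiPair χ sd ≠ 0 := xiPair_ne_zero_of_im hord _
  set I₁ : ℝ := ∫ σ in (1 / 2 : ℝ)..(1 / 2 + d),
    (Real.log ‖xiPair χ (σ + t * I)‖ - Real.log ‖xiPair χ ((σ + d : ℝ) + t * I)‖) with hI₁
  set R : ℝ := (logDeriv (xiPair χ) sd).re with hRdef
  set H : ℂ → ℝ := fun β ↦ (-(2 * β * (sd - 1 / 2)) / (1 - β * ((sd - 1 / 2) ^ 2 - 9 / 4))).re with hH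
  set Φ : ℂ → ℝ := fun β ↦ ∫ σ in (1 / 2 : ℝ)..(1 / 2 + d),
    (Real.log ‖1 - β * ((((σ : ℂ) + t * I) - 1 / 2) ^ 2 - 9 / 4)‖ -
      Real.log ‖1 - β * (((((σ + d : ℝ) : ℂ) + t * I) - 1 / 2) ^ 2 - 9 / 4)‖) with hΦ
  -- `Σ H(bₙ) = Re Ξ'/Ξ(s_d)`
  have hH' : HasSum (fun n ↦ H (b n)) R := by
    have hz : xiPair χ (1 / 2 + (sd - 1 / 2)) ≠ 0 := by rwa [add_sub_cancel]
    have h1' := logDeriv_xiPair_half_add_eq_tsum hbs h2 hprod hz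
    have hsum := (summable_logDeriv_factor hbs (9 / 4 : ℂ) (sd - 1 / 2)).hasSum
    rw [← h1'] at hsum
    have hshift : logDeriv (fun w ↦ xiPair χ (1 / 2 + w)) (sd - 1 / 2) = logDeriv (xiPair χ) sd := by
      rw [logDeriv_apply, logDeriv_apply, deriv_comp_const_add, add_sub_cancel]
    rw [hshift] at hsum
    exact Complex.hasSum_re hsum
  -- `Σ Φ(bₙ) = I₁`
  have hΦ' : HasSum (fun n ↦ Φ (b n)) I₁ :=
    hasSum_integral_pairPhi hbs h2 hprod (by linarith) hd1 hord
  -- the conjugate families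
  obtain ⟨e, he⟩ := exists_perm_eq_conj_pair hχ h1 hbs hmult
  have hΦc : HasSum (fun n ↦ Φ (conj (b n))) I₁ := by
    have ee : (fun n ↦ Φ (conj (b n))) = (fun n ↦ Φ (b n)) ∘ e :=
      funext fun n ↦ by simp only [Function.comp_apply, he n]
    rw [ee]; exact (Equiv.hasSum_iff e).2 hΦ'
  have hHc : HasSum (fun n ↦ H (conj (b n))) R := by
    have ee : (fun n ↦ H (conj (b n))) = (fun n ↦ H (b n)) ∘ e :=
      funext fun n ↦ by simp only [Function.comp_apply, he n]
    rw [ee]; exact (Equiv.hasSum_iff e).2 hH'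
  have hterm : ∀ n, -(Φ (b n) + Φ (conj (b n))) ≤ d ^ 2 * Real.log 4 * (H (b n) + H (conj (b n))) :=
    fun n ↦ neg_pairPhi_add_conj_le hB hχ h1 hprod hd hd1 hord n
  have hL : HasSum (fun n ↦ -(Φ (b n) + Φ (conj (b n)))) (-(I₁ + I₁)) := (hΦ'.add hΦc).neg
  have hRs : HasSum (fun n ↦ d ^ 2 * Real.log 4 * (H (b n) + H (conj (b n))))
      (d ^ 2 * Real.log 4 * (R + R)) := (hH'.add hHc).mul_left _
  have key := hasSum_le hterm hL hRs
  linarith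

/-! ### `Re ξ'/ξ(½ + d + it, χ) ≤ 2ζ'/ζ(1+2d) − ζ'/ζ(½+d) + ½ log(qt/2π) + ε'(t)` -/

/-- **The upper bound for `Re ξ'/ξ(s_d, χ)`, `s_d = ½ + d + it`** (Trudgian, displays before Lemma 3.7:
`Σ_ρ Re 1/(s−ρ) = ½ log(Q/π) + ½ Re Γ'/Γ((s+δ)/2) + Re L'/L(s, χ)` and, "for `σ = Re(s) > 1`,
`Re L'/L(s, χ) ≤ Σ_p log p/(p^σ − 1) = −ζ'(σ)/ζ(σ)`"): for `½ < d ≤ 1`, `t ≥ 1`, `χ ≠ 1`,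
`Re ξ'/ξ(s_d, χ) ≤ ½ log Q + ½ log t − ½ log 2π + ε'(t) + (2 ζ'/ζ(1+2d) − ζ'/ζ(½+d))`,
`ε'(t) = turingEps' t = 4/t² + π/(4t)` (explicit vertical Stirling bound in place of Trudgian's
Lemma 2.8), and with Booker's sharper `Re L'/L(σ+it) ≤ 2ζ'/ζ(2σ) − ζ'/ζ(σ)` ((4–11), the tree's
`Booker2006Turing.re_logDeriv_LFunction_le`; `≤ −ζ'/ζ(σ)` as printed since `ζ' < 0`).
[cite: Trudgian2011, §3.4 proof of Lemma 3.7 (displays before Lemma 3.7)] -/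
theorem re_logDeriv_dirichletXi_shift_le (h1 : χ ≠ 1) {d t : ℝ} (hd : 1 / 2 < d) (hd1 : d ≤ 1)
    (ht : 1 ≤ t) :
    (deriv (dirichletXi χ) (((1 / 2 + d : ℝ) : ℂ) + t * I) /
        dirichletXi χ (((1 / 2 + d : ℝ) : ℂ) + t * I)).re ≤
      Real.log q / 2 + Real.log t / 2 - Real.log 2 / 2 - Real.log π / 2 + turingEps' t +
        (2 * (deriv riemannZeta (2 * (1 / 2 + d) : ℝ) / riemannZeta (2 * (1 / 2 + d) : ℝ)).re -
          (deriv riemannZeta (1 / 2 + d : ℝ) / riemannZeta (1 / 2 + d : ℝ)).re) := by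
  set sd : ℂ := ((1 / 2 + d : ℝ) : ℂ) + t * I with hsd
  have ht0 : 0 < t := by linarith
  have hre : 0 < sd.re := by simp [hsd]; linarith
  have hre1 : 1 < (1 / 2 + d : ℝ) := by linarith
  have hL : χ.LFunction sd ≠ 0 :=
    LFunction_ne_zero_of_one_le_re χ (Or.inl h1) (by simp [hsd]; linarith)
  have hsub := re_logDeriv_dirichletXi_sub_eq h1 hre hL
  have hLb := Booker2006Turing.re_logDeriv_LFunction_le χ hre1 t
  -- the digamma term at `u = (s_d + a)/2`
  set u : ℂ := (sd + charParity χ) / 2 with hu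
  have hκ0 : (0 : ℝ) ≤ charParity χ := Nat.cast_nonneg _
  have hκ1 : (charParity χ : ℝ) ≤ 1 := by exact_mod_cast charParity_le_one χ
  have hure' : u.re = (1 / 2 + d + charParity χ) / 2 := by
    simp only [hu, hsd, div_ofNat_re, add_re, ofReal_re, mul_re, I_re, I_im, ofReal_im, natCast_re,
      mul_zero, sub_zero, mul_one, add_zero]
  have hure : 0 < u.re := by rw [hure']; linarith
  have huim : u.im = t / 2 := by
    simp only [hu, hsd, div_ofNat_im, add_im, ofReal_im, mul_im, I_re, I_im, ofReal_re, natCast_im,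
      mul_zero, mul_one, zero_add, add_zero]
  have huim' : u.im ≠ 0 := by rw [huim]; linarith
  have hψ := Literature.Analysis.SpecialFunctions.Complex.re_digamma_le_log_norm_add hure huim'
  have hnorm : t / 2 ≤ ‖u‖ := by
    have := abs_im_le_norm u
    rwa [huim, abs_of_pos (by linarith)] at this
  have hn0 : 0 < ‖u‖ := lt_of_lt_of_le (by linarith) hnorm
  -- `log ‖u‖ ≤ log t − log 2 + 25/(8t²)` from `‖u‖² ≤ (t/2)²(1 + 25/(4t²))`
  have hsq : ‖u‖ ^ 2 ≤ (t / 2) ^ 2 * (1 + 25 / (4 * t ^ 2)) := by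
    rw [Complex.sq_norm, Complex.normSq_apply, hure', huim]
    have h1' : ((1 / 2 + d + charParity χ) / 2) * ((1 / 2 + d + charParity χ) / 2) ≤ 25 / 16 := by
      nlinarith
    have e : (t / 2) ^ 2 * (1 + 25 / (4 * t ^ 2)) = t / 2 * (t / 2) + 25 / 16 := by
      field_simp; ring
    rw [e]; linarith
  have hlog : Real.log ‖u‖ ≤ Real.log t - Real.log 2 + 25 / (8 * t ^ 2) := by
    have h2 : Real.log (‖u‖ ^ 2) ≤ Real.log ((t / 2) ^ 2 * (1 + 25 / (4 * t ^ 2))) :=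
      Real.log_le_log (by positivity) hsq
    rw [Real.log_pow, Real.log_mul (by positivity) (by positivity), Real.log_pow,
      Real.log_div ht0.ne' two_ne_zero] at h2
    have h3 : Real.log (1 + 25 / (4 * t ^ 2)) ≤ 25 / (4 * t ^ 2) := by
      have := Real.log_le_sub_one_of_pos (show 0 < 1 + 25 / (4 * t ^ 2) by positivity)
      linarith
    have e : (25 : ℝ) / (8 * t ^ 2) = 25 / (4 * t ^ 2) / 2 := by field_simp; ring
    rw [e]
    push_cast at h2
    linarith
  have hinv : 1 / (2 * ‖u‖ ^ 2) ≤ 2 / t ^ 2 := by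
    rw [div_le_div_iff₀ (by positivity) (by positivity)]
    nlinarith [hnorm, hn0]
  have habs : π / (4 * |u.im|) = π / (2 * t) := by
    rw [huim, abs_of_pos (by linarith)]; ring
  rw [habs] at hψ
  simp only [turingEps']
  have e4 : π / (4 * t) = π / (2 * t) / 2 := by field_simp; ring
  have e5 : (4 : ℝ) / t ^ 2 = 25 / (8 * t ^ 2) / 2 + 2 / t ^ 2 / 2 + 23 / (16 * t ^ 2) := by
    field_simp; ring
  have h7 : 0 ≤ 23 / (16 * t ^ 2) := by positivity
  rw [e4, e5]
  linarith

/-! ### The pair form of Trudgian's Lemma 3.7 -/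

/-- `log|Ξ_χ(s)| = log|ξ(s,χ)| + log|ξ(s,χ̄)|` off the zeros. [folklore] -/
private theorem log_norm_xiPair_eq {s : ℂ} (h : xiPair χ s ≠ 0) :
    Real.log ‖xiPair χ s‖ = Real.log ‖dirichletXi χ s‖ + Real.log ‖dirichletXi χ⁻¹ s‖ := by
  have h' : dirichletXi χ s * dirichletXi χ⁻¹ s ≠ 0 := h
  rw [show xiPair χ s = dirichletXi χ s * dirichletXi χ⁻¹ s from rfl, norm_mul,
    Real.log_mul (norm_ne_zero_iff.2 (left_ne_zero_of_mul h'))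
      (norm_ne_zero_iff.2 (right_ne_zero_of_mul h'))]

omit [NeZero q] in
/-- The inverse of a primitive character is primitive. [folklore] -/
private theorem isPrimitive_inv'' (hχ : χ.IsPrimitive) : χ⁻¹.IsPrimitive := by
  rw [DirichletCharacter.isPrimitive_def, DirichletCharacter.conductor_inv]; exact hχ

/-- **Trudgian 2011, Lemma 3.7, for the pair `L(s,χ)L(s,χ̄)` (exact form, conditional on Booker's
inequality).**  For a primitive `χ` modulo `Q > 1`, `½ < d ≤ 1`, `t ≥ 1` the ordinate of no zero of
`L(s,χ)` or `L(s,χ̄)` in the critical strip,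
`−∫_{1/2}^∞ (log|L(σ+it,χ)| + log|L(σ+it,χ̄)|) dσ
   ≤ d² log 4 · (Re ξ'/ξ(s_d,χ) + Re ξ'/ξ(s_d,χ̄)) − 2d²(½ log Q + ½ log t − ½ log 2π − ε(t)) − 2 I(d)`
`  ≤ 2·[d² log 4 (2ζ'/ζ(1+2d) − ζ'/ζ(½+d) + ½ log(Qt/2π) + ε'(t)) − d²(½ log(Qt/2π) − ε(t)) − I(d)]`,
the sum over `χ, χ̄` of the source's `−∫ log|L| ≤ a₂ + b₂ log(Qt/2π)` with `b₂ = (d²/2)(log 4 − 1)`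
and `a₂` as printed up to the explicit error terms `ε(t) = turingEps t`, `ε'(t) = turingEps' t` (in
place of `13d²/t₀²`) and Booker's `2ζ'/ζ(1+2d)` refinement (`≤ 0`).  This is the lower-bound input
of Turing's method in the pair form consumed by `TuringDirichlet.turing_lehman_lower_bound`
(`∫S_χ + ∫S_χ̄`).  Proof as printed: the decomposition and `I(d)`, `Γ`-parts of
`CertifiedDirichletLTuringLowerBound.lean` for `χ` and for `χ̄`, the zeros' part
`integral_log_norm_xiPair_sub_shift_ge` for the pair, and `re_logDeriv_dirichletXi_shift_le`.
[cite: Trudgian2011, §3.4 Lemma 3.7] -/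
theorem neg_setIntegral_log_norm_LFunction_pair_le (hB : Trudgian2011_lemma_2_10) (hq : 1 < q)
    (hχ : χ.IsPrimitive) {d t : ℝ} (hd : 1 / 2 < d) (hd1 : d ≤ 1) (ht : 1 ≤ t)
    (hz : ∀ ρ ∈ charNontrivialZeros χ, ρ.im ≠ t) (hz' : ∀ ρ ∈ charNontrivialZeros χ⁻¹, ρ.im ≠ t) :
    -((∫ σ in Ioi (1 / 2 : ℝ), Real.log ‖χ.LFunction (σ + t * I)‖) +
        ∫ σ in Ioi (1 / 2 : ℝ), Real.log ‖χ⁻¹.LFunction (σ + t * I)‖) ≤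
      2 * (d ^ 2 * Real.log 4 *
          ((2 * (deriv riemannZeta (2 * (1 / 2 + d) : ℝ) / riemannZeta (2 * (1 / 2 + d) : ℝ)).re -
              (deriv riemannZeta (1 / 2 + d : ℝ) / riemannZeta (1 / 2 + d : ℝ)).re) +
            Real.log q / 2 + Real.log t / 2 - Real.log 2 / 2 - Real.log π / 2 + turingEps' t) -
        d ^ 2 * (Real.log q / 2 + Real.log t / 2 - Real.log 2 / 2 - Real.log π / 2 - turingEps t) -
        turingI d) := by
  have hq1 : q ≠ 1 := by omega
  have h1 : χ ≠ 1 := SelbergDirichlet.ne_one_of_isPrimitive hq1 hχ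
  have h1' : χ⁻¹ ≠ 1 := inv_ne_one.mpr h1
  have hχ' : χ⁻¹.IsPrimitive := isPrimitive_inv'' hχ
  have hd0 : (0 : ℝ) ≤ d := by linarith
  have hordΞ := xiPair_ordinate_ne hχ h1 hz hz'
  -- the pieces for `χ` and `χ̄`
  have hdec := setIntegral_Ioi_half_log_norm_LFunction_eq_decomp h1 hd0 hz
  have hdec' := setIntegral_Ioi_half_log_norm_LFunction_eq_decomp h1' hd0 hz'
  have hA := integral_log_norm_LFunction_sub_shift_ge hχ h1 hd0 ht hz
  have hA' := integral_log_norm_LFunction_sub_shift_ge hχ' h1' hd0 ht hz'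
  have hJ₁ := intervalIntegral_log_norm_LFunction_ge h1 hd hz
  have hJ₁' := intervalIntegral_log_norm_LFunction_ge h1' hd hz'
  have hJ₂ := setIntegral_Ioi_log_norm_LFunction_ge h1 hd hz
  have hJ₂' := setIntegral_Ioi_log_norm_LFunction_ge h1' hd hz'
  -- the `ξ`-parts add up to the `Ξ`-part
  have hξ : ∀ x : ℝ, dirichletXi χ (x + t * I) ≠ 0 := fun x ↦
    dirichletXi_ne_zero_of_im_eq hχ h1 hz (by simp)
  have hξ' : ∀ x : ℝ, dirichletXi χ⁻¹ (x + t * I) ≠ 0 := fun x ↦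
    dirichletXi_ne_zero_of_im_eq hχ' h1' hz' (by simp)
  have hΞ : ∀ x : ℝ, xiPair χ (x + t * I) ≠ 0 := fun x ↦ mul_ne_zero (hξ x) (hξ' x)
  have hcont : ∀ {ψ : DirichletCharacter ℂ q}, ψ ≠ 1 → (∀ x : ℝ, dirichletXi ψ (x + t * I) ≠ 0) →
      Continuous fun x : ℝ ↦ Real.log ‖dirichletXi ψ (x + t * I)‖ := by
    intro ψ hψ hne
    have hc : Continuous fun x : ℝ ↦ dirichletXi ψ (x + t * I) :=
      (differentiable_dirichletXi hψ).continuous.comp (by fun_prop)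
    exact continuous_iff_continuousAt.2 fun x ↦ (hc.continuousAt.norm).log (norm_ne_zero_iff.2 (hne x))
  have hc1 := hcont h1 hξ
  have hc2 := hcont h1' hξ'
  have Iχ : IntervalIntegrable (fun σ : ℝ ↦ Real.log ‖dirichletXi χ (σ + t * I)‖ -
      Real.log ‖dirichletXi χ ((σ + d : ℝ) + t * I)‖) volume (1 / 2) (1 / 2 + d) :=
    (hc1.intervalIntegrable _ _).sub ((hc1.comp (continuous_id.add continuous_const :
      Continuous fun σ : ℝ ↦ σ + d)).intervalIntegrable _ _)
  have Iχ' : IntervalIntegrable (fun σ : ℝ ↦ Real.log ‖dirichletXi χ⁻¹ (σ + t * I)‖ -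
      Real.log ‖dirichletXi χ⁻¹ ((σ + d : ℝ) + t * I)‖) volume (1 / 2) (1 / 2 + d) :=
    (hc2.intervalIntegrable _ _).sub ((hc2.comp (continuous_id.add continuous_const :
      Continuous fun σ : ℝ ↦ σ + d)).intervalIntegrable _ _)
  have hsum : (∫ σ in (1 / 2 : ℝ)..(1 / 2 + d),
        (Real.log ‖dirichletXi χ (σ + t * I)‖ - Real.log ‖dirichletXi χ ((σ + d : ℝ) + t * I)‖)) +
      (∫ σ in (1 / 2 : ℝ)..(1 / 2 + d),
        (Real.log ‖dirichletXi χ⁻¹ (σ + t * I)‖ -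
          Real.log ‖dirichletXi χ⁻¹ ((σ + d : ℝ) + t * I)‖)) =
      ∫ σ in (1 / 2 : ℝ)..(1 / 2 + d),
        (Real.log ‖xiPair χ (σ + t * I)‖ - Real.log ‖xiPair χ ((σ + d : ℝ) + t * I)‖) := by
    rw [← intervalIntegral.integral_add Iχ Iχ']
    refine intervalIntegral.integral_congr fun σ _ ↦ ?_
    show _ = Real.log ‖xiPair χ (σ + t * I)‖ - Real.log ‖xiPair χ ((σ + d : ℝ) + t * I)‖
    rw [log_norm_xiPair_eq (hΞ σ), log_norm_xiPair_eq (hΞ (σ + d))]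
    ring
  -- the zeros' part and the bound for `Re Ξ'/Ξ(s_d)`
  have hZ := integral_log_norm_xiPair_sub_shift_ge hB hχ h1 hd hd1 hordΞ
  have hR := re_logDeriv_dirichletXi_shift_le h1 hd hd1 ht (t := t)
  have hR' := re_logDeriv_dirichletXi_shift_le h1' hd hd1 ht (t := t)
  set sd : ℂ := ((1 / 2 + d : ℝ) : ℂ) + t * I with hsd
  have hsdre : 0 < sd.re := by simp [hsd]; linarith
  have hxd : logDeriv (xiPair χ) sd = deriv (dirichletXi χ) sd / dirichletXi χ sd +
      deriv (dirichletXi χ⁻¹) sd / dirichletXi χ⁻¹ sd := by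
    have hfun : xiPair χ = fun s ↦ dirichletXi χ s * dirichletXi χ⁻¹ s := by funext s; rfl
    rw [hfun, logDeriv_mul sd (hξ _) (hξ' _) ((differentiable_dirichletXi h1) _)
      ((differentiable_dirichletXi h1') _), logDeriv_apply, logDeriv_apply]
  have hre_eq : (logDeriv (xiPair χ) sd).re =
      (deriv (dirichletXi χ) sd / dirichletXi χ sd).re +
        (deriv (dirichletXi χ⁻¹) sd / dirichletXi χ⁻¹ sd).re := by
    rw [hxd, Complex.add_re]
  have hlog4 : 0 ≤ d ^ 2 * Real.log 4 := by
    have := Real.log_nonneg (by norm_num : (1:ℝ) ≤ 4); positivity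
  rw [hre_eq] at hZ
  have hRR := mul_le_mul_of_nonneg_left (add_le_add hR hR') hlog4
  simp only [turingI]
  rw [hdec, hdec']
  linarith

end TuringDirichlet

end Literature.NumberTheory.LFunctions

end
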